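import Summits.QuantumFields.YangMills.Theorems.BalabanUVNodesN21HistoriesModelADefs

/-!
# YM-DAG node N21 (= NE7c) — ROW A⁵-S: the histories road's OWN SMALL EVENT and the WINDOWED model-A constructor (lens Cards 17∕18∕21): `smallEvent` (the support of the
# leaf's indicator product), the windowed weights `modelAWeightW` whose live-small slots OUTSIDE the window keep their indicator inside the density — (RESUM) still a THEOREM
# (`sum_histLaw_modelAW`), `small τ ⊆ W` by construction, and ν_τ-a.e. every UV live-small slot IS small — plus the partition of unity with CAUSAL statistics;
# the lens's `Sketch-nearmiss-g7.lean` §A (defs half) ∕ §C ∕ §E VERBATIM — the definition-lane support leaf of module 20g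

Track A of `YM-PLAN.md` (cell `pub-ymgap`, HUMAN RULING D-0062), node **N21**; R134 fan-out seat `pub-ymgap-dag-n21-d` (s2), generation 6, module 20h (definition lane, as 20f was).
4 `def` + 15 theorems, 0 `sorry`, 0 `instance`, 0 `notation`, standard axioms; COUNT-NEUTRAL; KEY-FREE; `--supports` the K3⁗ item `SpineGivenEndpointR13Sep`
(stmt-QuantumFields-20292) as a helper.  NO Theses import, NO `Node00.Record13` import.  THIS FILE IS the planner seat `ym-lens-BalabanUVNodes-nearmiss` g7's farm-checked sketch
`Sketch-nearmiss-g7.lean` (sha16 326ceaa2d7da4764) §A (the `smallEvent` half: def + four lemmas) ∕ §C ∕ §E VERBATIM (namespace renamed; CREDIT: ym-lens-BalabanUVNodes-nearmiss g7, memo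
`LENS-nearmiss.md` v7.0 8713c929b71745b4, Cards 17 ∕ 18 ∕ 21, FAN-OUT ROW A⁵), as 18a ∕ 20b ∕ 20e ∕ 20f were g4's ∕ g5's ∕ g6's.  Imports module 20f `BalabanUVNodesN21HistoriesModelADefs`
(p497290: `causalFactor`, `liveSmall`, `sum_prod_causalFactor_eq_one`, `sum_causalFactor`, `withDensity_finsetSum'`; brings the `pub-balaban` leaf `ShellMeasureRootCompositionHistories`).

THE POINT (lens Cards 17∕18).  After modules 20e ∕ 23b the histories road displays per run (RESUM), the a.e. closeness `hcloseX`, the window, the box.  `hcloseX` AS TYPED (two-run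
closeness `ν^X_τ`-a.e. UNCONDITIONALLY) is too strong for the model-A constructor of 20f: `ν_τ = restFactor_τ·γ_t` charges configurations where an older live-small slot of τ is
LARGE, and N16's junction is closeness CONDITIONAL on small fields.  Two objects repair this at no cost: (§A) the history's OWN SMALL EVENT `smallEvent sm u ϑ = {ω | ∀ s ∈ sm,
u_s ω < ϑ_s}` — `smallProd = 1_{smallEvent}`, so the leaf's letters are blind off it (module 20g §1) and closeness is only ever needed ON it; (§C) the WINDOWED constructor: enumerate
ALL live slots (older levels included — N16's antecedent reads them) but let only the WINDOW slots `W` be shell slots (`liveSmallW W live τ ⊆ W`), keeping the indicators of the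
live-small slots outside `W` INSIDE the density `restFactorW` — (RESUM) is still a theorem (`sum_histLaw_modelAW`, causal liveness) and `ν_τ`-a.e. every live-small slot outside the
window IS small (`ae_uvSmall_modelAW`); (§C′, this seat) `causalFactor_le_one`, `restFactorW_le_one`, `modelAWeightW_le` (`ν_τ ≤ γ`),
`isFiniteMeasure_modelAWeightW` — module 20e's finiteness instance for the constructor; (§E) the hierarchical partition of unity survives statistics that read the older labels (`sum_prod_causalFactor_eq_one_causal`) — (RESUM) ∕ E1
survive history-dependent statistics, the threshold selection does not (lens Card 21: test REFERENCE statistics).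

HONEST FRAMING (binding).  [folklore] indicators ∕ `withDensity` ∕ finite combinatorics on the cell's typed letters; a MODEL constructor (nothing of Bałaban's expansion is typed or
asserted); (M1) for print's FIXED thresholds untouched; NE7c is NOT PRINTED and NOT PROVED; **N21 is NOT discharged**; K3⁗ NOT claimed; typed 28∕28, discharged count untouched; one
finite four-torus programme at fixed `ε` — NOT ℝ⁴, NOT infinite volume, NOT OS, NOT a mass gap, NOT Clay.  No decl below carries a cite tag.
-/

set_option autoImplicit false

noncomputable section

open scoped BigOperators ENNReal
open MeasureTheory Set

namespace Summit.QuantumFields.YangMills.Theorems.N21HistoriesWindowedModelADefs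

open Literature.MathematicalPhysics.QuantumFieldTheory.Balaban1983to89
open Literature.MathematicalPhysics.QuantumFieldTheory.Balaban1983to89.T4IndicatorShell (smallInd)
open Summit.QuantumFields.BalabanUV.T4Continuum.ShellMeasureRootCompositionPush (measurable_smallInd)
open Summit.QuantumFields.BalabanUV.T4Continuum.ShellMeasureRootCompositionHistories
  (smallProd smallProd_nonneg measurable_smallProd histLaw)
open Summit.QuantumFields.YangMills.Theorems.N21HistoriesModelADefs
  (causalFactor causalFactor_tt causalFactor_nonneg measurable_causalFactor sum_prod_causalFactor_eq_one liveSmall withDensity_finsetSum')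

/-! ## §A the history's own small event (lens Sketch-g7 §A, defs half, VERBATIM) -/

section Blind

variable {Ω σ : Type*}

/-- THE OWN SMALL EVENT of a history with live-small region `sm`, tested variables `u`, thresholds `ϑ`:
`E = {ω | ∀ s ∈ sm, u_s(ω) < ϑ_s}` — the support of the leaf's indicator product `smallProd sm u ϑ`. [folklore] -/
def smallEvent (sm : Finset σ) (u : σ → Ω → ℝ) (ϑ : σ → ℝ) : Set Ω := {ω | ∀ s ∈ sm, u s ω < ϑ s}

variable [DecidableEq σ]

omit [DecidableEq σ] in
/-- on the own small event the indicator product is `1` … [folklore] -/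
theorem smallProd_eq_one_of_mem {sm : Finset σ} {u : σ → Ω → ℝ} {ϑ : σ → ℝ} {ω : Ω} (h : ω ∈ smallEvent sm u ϑ) :
    smallProd sm u ϑ ω = 1 :=
  Finset.prod_eq_one fun s hs => by simp [smallInd, h s hs]

omit [DecidableEq σ] in
/-- … and off it, `0`. [folklore] -/
theorem smallProd_eq_zero_of_not_mem {sm : Finset σ} {u : σ → Ω → ℝ} {ϑ : σ → ℝ} {ω : Ω} (h : ω ∉ smallEvent sm u ϑ) :
    smallProd sm u ϑ ω = 0 := by
  simp only [smallEvent, mem_setOf_eq, not_forall] at h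
  obtain ⟨s, hs, hlt⟩ := h
  exact Finset.prod_eq_zero hs (by simp [smallInd, hlt])

omit [DecidableEq σ] in
/-- `smallProd = 1_{smallEvent}`. [folklore] -/
theorem smallProd_eq_indicator (sm : Finset σ) (u : σ → Ω → ℝ) (ϑ : σ → ℝ) :
    smallProd sm u ϑ = (smallEvent sm u ϑ).indicator 1 := by
  funext ω
  by_cases h : ω ∈ smallEvent sm u ϑ
  · rw [indicator_of_mem h, Pi.one_apply, smallProd_eq_one_of_mem h]
  · rw [indicator_of_notMem h, smallProd_eq_zero_of_not_mem h]

variable [MeasurableSpace Ω]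

omit [DecidableEq σ] in
/-- the own small event is measurable along measurable tested variables. [folklore] -/
theorem measurableSet_smallEvent (sm : Finset σ) {u : σ → Ω → ℝ} (hu : ∀ s, Measurable (u s)) (ϑ : σ → ℝ) :
    MeasurableSet (smallEvent sm u ϑ) := by
  have h : smallEvent sm u ϑ = ⋂ s ∈ sm, {ω | u s ω < ϑ s} := by
    ext ω; simp [smallEvent]
  rw [h]
  exact Finset.measurableSet_biInter sm fun s _ => hu s measurableSet_Iio


end Blind

/-! ## §C the WINDOWED model-A constructor (lens Sketch-g7 §C, Card 18, VERBATIM) -/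

section ModelAW

variable {Ω : Type*} [MeasurableSpace Ω] {n : ℕ}

/-- the WINDOWED live-small region of history `τ`: live slots labelled small that lie in the window `W` (the leaf's `small τ ⊆ C K`). [folklore] -/
def liveSmallW (W : Finset (Fin n)) (live : (Fin n → Bool) → Fin n → Bool) (τ : Fin n → Bool) : Finset (Fin n) :=
  Finset.univ.filter fun i => (live τ i = true ∧ τ i = true) ∧ i ∈ W

/-- the WINDOWED remaining density: the factors of every slot that is not (live-small AND in the window) — large-field factors `1 − χ`, dead
slots, AND the small-field indicators `χ` of the live-small slots OUTSIDE the window (the UV levels). [folklore] -/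
noncomputable def restFactorW (W : Finset (Fin n)) (live : (Fin n → Bool) → Fin n → Bool) (τ : Fin n → Bool) (u : Fin n → Ω → ℝ)
    (ϑ : Fin n → ℝ) (ω : Ω) : ℝ :=
  ∏ i ∈ Finset.univ.filter (fun i => ¬((live τ i = true ∧ τ i = true) ∧ i ∈ W)),
    causalFactor (live τ i) (τ i) (smallInd (u i ω) (ϑ i))

/-- **THE WINDOWED MODEL-A WEIGHT** `ν_τ := restFactorW_τ · γ`. [folklore] -/
noncomputable def modelAWeightW (γ : Measure Ω) (W : Finset (Fin n)) (live : (Fin n → Bool) → Fin n → Bool) (u : Fin n → Ω → ℝ)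
    (ϑ : Fin n → ℝ) (τ : Fin n → Bool) : Measure Ω :=
  γ.withDensity fun ω => ENNReal.ofReal (restFactorW W live τ u ϑ ω)

omit [MeasurableSpace Ω] in
/-- the windowed live-small region lies in the window (module 20's `hsmall`). [folklore] -/
theorem liveSmallW_subset (W : Finset (Fin n)) (live : (Fin n → Bool) → Fin n → Bool) (τ : Fin n → Bool) :
    liveSmallW W live τ ⊆ W := fun _ hi => ((Finset.mem_filter.1 hi).2).2

omit [MeasurableSpace Ω] in
/-- the windowed remaining density is nonnegative. [folklore] -/
theorem restFactorW_nonneg (W : Finset (Fin n)) (live : (Fin n → Bool) → Fin n → Bool) (τ : Fin n → Bool) (u : Fin n → Ω → ℝ)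
    (ϑ : Fin n → ℝ) (ω : Ω) : 0 ≤ restFactorW W live τ u ϑ ω :=
  Finset.prod_nonneg fun _ _ => causalFactor_nonneg _ _ (T4IndicatorShell.smallInd_nonneg _ _) (T4IndicatorShell.smallInd_le_one _ _)

/-- the windowed remaining density is measurable along measurable statistics. [folklore] -/
theorem measurable_restFactorW (W : Finset (Fin n)) (live : (Fin n → Bool) → Fin n → Bool) (τ : Fin n → Bool) {u : Fin n → Ω → ℝ}
    (hu : ∀ i, Measurable (u i)) (ϑ : Fin n → ℝ) : Measurable (restFactorW W live τ u ϑ) := by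
  unfold restFactorW
  exact Finset.measurable_prod _ fun i _ => (measurable_causalFactor _ _).comp (measurable_smallInd (hu i) (ϑ i))

omit [MeasurableSpace Ω] in
/-- full factor product = windowed remaining density × windowed live-small indicator product. [folklore] -/
theorem restFactorW_mul_smallProd (W : Finset (Fin n)) (live : (Fin n → Bool) → Fin n → Bool) (τ : Fin n → Bool) (u : Fin n → Ω → ℝ)
    (ϑ : Fin n → ℝ) (ω : Ω) :
    restFactorW W live τ u ϑ ω * smallProd (liveSmallW W live τ) u ϑ ω = ∏ i, causalFactor (live τ i) (τ i) (smallInd (u i ω) (ϑ i)) := by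
  have hsm : smallProd (liveSmallW W live τ) u ϑ ω =
      ∏ i ∈ Finset.univ.filter (fun i => (live τ i = true ∧ τ i = true) ∧ i ∈ W), causalFactor (live τ i) (τ i) (smallInd (u i ω) (ϑ i)) := by
    unfold smallProd liveSmallW
    refine Finset.prod_congr rfl fun i hi => ?_
    obtain ⟨⟨h1, h2⟩, _⟩ := (Finset.mem_filter.1 hi).2
    simp [h1, h2]
  rw [hsm, restFactorW, mul_comm]
  exact Finset.prod_filter_mul_prod_filter_not _ _ _

/-- **(RESUM) IS A THEOREM FOR THE WINDOWED CONSTRUCTOR TOO**: `Σ_τ histLaw (modelAWeightW γ W …) (liveSmallW W live τ) u ϑ = γ` at every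
threshold vector, for a CAUSAL liveness rule. [folklore] -/
theorem sum_histLaw_modelAW (γ : Measure Ω) (W : Finset (Fin n)) (live : (Fin n → Bool) → Fin n → Bool)
    (hc : ∀ τ τ' i, (∀ j, j < i → τ j = τ' j) → live τ i = live τ' i) {u : Fin n → Ω → ℝ} (hu : ∀ i, Measurable (u i))
    (ϑ : Fin n → ℝ) :
    ∑ τ : Fin n → Bool, histLaw (modelAWeightW γ W live u ϑ τ) (liveSmallW W live τ) u ϑ = γ := by
  have hterm : ∀ τ : Fin n → Bool, histLaw (modelAWeightW γ W live u ϑ τ) (liveSmallW W live τ) u ϑ =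
      γ.withDensity fun ω => ENNReal.ofReal (∏ i, causalFactor (live τ i) (τ i) (smallInd (u i ω) (ϑ i))) := fun τ => by
    unfold histLaw modelAWeightW
    rw [← withDensity_mul _ (measurable_restFactorW W live τ hu ϑ).ennreal_ofReal (measurable_smallProd _ hu ϑ).ennreal_ofReal]
    refine congrArg _ (funext fun ω => ?_)
    simp only [Pi.mul_apply]
    rw [← ENNReal.ofReal_mul (restFactorW_nonneg W live τ u ϑ ω), restFactorW_mul_smallProd]
  simp_rw [hterm]
  rw [← withDensity_finsetSum' Finset.univ γ
    (fun τ ω => ENNReal.ofReal (∏ i, causalFactor (live τ i) (τ i) (smallInd (u i ω) (ϑ i))))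
    fun τ => (Finset.measurable_prod _ fun i _ =>
      (measurable_causalFactor (live τ i) (τ i)).comp (measurable_smallInd (hu i) (ϑ i))).ennreal_ofReal]
  have h1 : (fun ω => ∑ τ : Fin n → Bool, ENNReal.ofReal (∏ i, causalFactor (live τ i) (τ i) (smallInd (u i ω) (ϑ i)))) = 1 := by
    funext ω
    rw [← ENNReal.ofReal_sum_of_nonneg fun τ _ => Finset.prod_nonneg fun i _ =>
      causalFactor_nonneg _ _ (T4IndicatorShell.smallInd_nonneg _ _) (T4IndicatorShell.smallInd_le_one _ _),
      sum_prod_causalFactor_eq_one n live hc, ENNReal.ofReal_one]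
    rfl
  rw [h1, withDensity_one]

/-- **ν_τ-A.E., EVERY LIVE-SMALL SLOT OUTSIDE THE WINDOW IS SMALL** (its indicator `χ` is a factor of the density). [folklore] -/
theorem ae_uvSmall_modelAW (γ : Measure Ω) (W : Finset (Fin n)) (live : (Fin n → Bool) → Fin n → Bool) (τ : Fin n → Bool)
    {u : Fin n → Ω → ℝ} (hu : ∀ i, Measurable (u i)) (ϑ : Fin n → ℝ) :
    ∀ᵐ ω ∂(modelAWeightW γ W live u ϑ τ), ∀ i, live τ i = true → τ i = true → i ∉ W → u i ω < ϑ i := by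
  rw [modelAWeightW, ae_withDensity_iff (measurable_restFactorW W live τ hu ϑ).ennreal_ofReal]
  refine Filter.Eventually.of_forall fun ω hω i hl hτ hW => ?_
  by_contra hlt
  refine hω ?_
  rw [ENNReal.ofReal_eq_zero]
  refine le_of_eq (Finset.prod_eq_zero (Finset.mem_filter.2 ⟨Finset.mem_univ _, fun h => hW h.2⟩) ?_)
  simp [hl, hτ, smallInd, hlt]

end ModelAW

/-! ## §C′ (this seat) the windowed weights are dominated by the reference law, hence finite -/

section Finite

variable {Ω : Type*} [MeasurableSpace Ω] {n : ℕ}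

omit [MeasurableSpace Ω] in
/-- every causal factor of an indicator value in `[0,1]` is at most `1` (the four cases are `x`, `1 − x`, `1`, `0`). [folklore] -/
theorem causalFactor_le_one (live lab : Bool) {x : ℝ} (hx0 : 0 ≤ x) (hx1 : x ≤ 1) : causalFactor live lab x ≤ 1 := by
  cases live <;> cases lab <;> simp [causalFactor] <;> linarith

omit [MeasurableSpace Ω] in
/-- the windowed remaining density is at most `1`. [folklore] -/
theorem restFactorW_le_one (W : Finset (Fin n)) (live : (Fin n → Bool) → Fin n → Bool) (τ : Fin n → Bool) (u : Fin n → Ω → ℝ)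
    (ϑ : Fin n → ℝ) (ω : Ω) : restFactorW W live τ u ϑ ω ≤ 1 :=
  Finset.prod_le_one (fun _ _ => causalFactor_nonneg _ _ (T4IndicatorShell.smallInd_nonneg _ _) (T4IndicatorShell.smallInd_le_one _ _))
    fun _ _ => causalFactor_le_one _ _ (T4IndicatorShell.smallInd_nonneg _ _) (T4IndicatorShell.smallInd_le_one _ _)

/-- **THE WINDOWED MODEL-A WEIGHT IS DOMINATED BY ITS REFERENCE LAW**: `ν_τ ≤ γ` (density `≤ 1`). [folklore] -/
theorem modelAWeightW_le (γ : Measure Ω) (W : Finset (Fin n)) (live : (Fin n → Bool) → Fin n → Bool) (u : Fin n → Ω → ℝ) (ϑ : Fin n → ℝ)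
    (τ : Fin n → Bool) : modelAWeightW γ W live u ϑ τ ≤ γ := by
  unfold modelAWeightW
  calc γ.withDensity (fun ω => ENNReal.ofReal (restFactorW W live τ u ϑ ω)) ≤ γ.withDensity 1 :=
        withDensity_mono (Filter.Eventually.of_forall fun ω => ENNReal.ofReal_le_one.2 (restFactorW_le_one W live τ u ϑ ω))
    _ = γ := withDensity_one

/-- … hence a finite measure whenever the reference law is (module 20e's `IsFiniteMeasure (ν^X K a t τ)` instance for the constructor). [folklore] -/
theorem isFiniteMeasure_modelAWeightW (γ : Measure Ω) [IsFiniteMeasure γ] (W : Finset (Fin n)) (live : (Fin n → Bool) → Fin n → Bool)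
    (u : Fin n → Ω → ℝ) (ϑ : Fin n → ℝ) (τ : Fin n → Bool) : IsFiniteMeasure (modelAWeightW γ W live u ϑ τ) :=
  isFiniteMeasure_of_le γ (modelAWeightW_le γ W live u ϑ τ)

end Finite

/-! ## §E the partition of unity with CAUSAL statistics (lens Sketch-g7 §E, Card 21, VERBATIM) -/

section CausalStat

open Summit.QuantumFields.YangMills.Theorems.N21HistoriesModelADefs (sum_causalFactor)

/-- **THE HIERARCHICAL PARTITION OF UNITY WITH CAUSAL STATISTICS**: if BOTH the liveness rule AND the indicator value of slot `i` may read the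
older labels `τ j`, `j < i` (print: the slot's statistic is the minimiser of the variational problem on the region the history has built so
far), the products still sum to `1`.  (RESUM) and E1 therefore survive history-dependent statistics; module 18∕20's threshold SELECTION does not
(its envelope laws must not see the history) — memo Card 21: test REFERENCE statistics. [folklore] -/
theorem sum_prod_causalFactor_eq_one_causal : ∀ (n : ℕ) (live : (Fin n → Bool) → Fin n → Bool) (χ : (Fin n → Bool) → Fin n → ℝ)
    (_hc : ∀ τ τ' i, (∀ j, j < i → τ j = τ' j) → live τ i = live τ' i)
    (_hχ : ∀ τ τ' i, (∀ j, j < i → τ j = τ' j) → χ τ i = χ τ' i),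
    ∑ τ : Fin n → Bool, ∏ i, causalFactor (live τ i) (τ i) (χ τ i) = 1
  | 0, live, χ, _, _ => by simp
  | n + 1, live, χ, hc, hχ => by
    rw [← Fintype.sum_equiv (Fin.consEquiv fun _ => Bool)
      (fun p => ∏ i, causalFactor (live (Fin.cons p.1 p.2 : Fin (n + 1) → Bool) i) ((Fin.cons p.1 p.2 : Fin (n + 1) → Bool) i)
        (χ (Fin.cons p.1 p.2 : Fin (n + 1) → Bool) i))
      (fun τ => ∏ i, causalFactor (live τ i) (τ i) (χ τ i)) (fun _ => rfl), Fintype.sum_prod_type]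
    simp only [Fin.prod_univ_succ, Fin.cons_zero, Fin.cons_succ]
    have h0 : ∀ τ : Fin (n + 1) → Bool, live τ 0 = live (fun _ => true) 0 := fun τ =>
      hc τ _ 0 fun j hj => absurd hj (Nat.not_lt_zero _)
    have h0χ : ∀ τ : Fin (n + 1) → Bool, χ τ 0 = χ (fun _ => true) 0 := fun τ =>
      hχ τ _ 0 fun j hj => absurd hj (Nat.not_lt_zero _)
    have htail : ∀ b : Bool, ∑ τ' : Fin n → Bool, ∏ i : Fin n,
        causalFactor (live (Fin.cons b τ' : Fin (n + 1) → Bool) i.succ) (τ' i) (χ (Fin.cons b τ' : Fin (n + 1) → Bool) i.succ) = 1 :=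
      fun b => by
      refine sum_prod_causalFactor_eq_one_causal n (fun τ' i => live (Fin.cons b τ' : Fin (n + 1) → Bool) i.succ)
        (fun τ' i => χ (Fin.cons b τ' : Fin (n + 1) → Bool) i.succ) (fun τ τ' i hτ => ?_) (fun τ τ' i hτ => ?_)
      · refine hc _ _ i.succ fun j hj => ?_
        cases j using Fin.cases with
        | zero => rfl
        | succ j' => simp only [Fin.cons_succ]; exact hτ j' (Fin.succ_lt_succ_iff.1 hj)
      · refine hχ _ _ i.succ fun j hj => ?_
        cases j using Fin.cases with
        | zero => rfl
        | succ j' => simp only [Fin.cons_succ]; exact hτ j' (Fin.succ_lt_succ_iff.1 hj)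
    have hsplit : ∀ b : Bool, ∑ τ' : Fin n → Bool,
        causalFactor (live (Fin.cons b τ' : Fin (n + 1) → Bool) 0) b (χ (Fin.cons b τ' : Fin (n + 1) → Bool) 0) *
          ∏ i : Fin n, causalFactor (live (Fin.cons b τ' : Fin (n + 1) → Bool) i.succ) (τ' i)
            (χ (Fin.cons b τ' : Fin (n + 1) → Bool) i.succ) =
        causalFactor (live (fun _ => true) 0) b (χ (fun _ => true) 0) := fun b => by
      simp_rw [h0, h0χ]
      rw [← Finset.mul_sum, htail b, mul_one]
    simp_rw [hsplit]
    simpa using sum_causalFactor (live (fun _ => true) 0) (χ (fun _ => true) 0)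

end CausalStat

end Summit.QuantumFields.YangMills.Theorems.N21HistoriesWindowedModelADefs

end
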